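import Literature.IUT.LogVolume.Theorem110
import Literature.IUT.LogVolume.Corollary22PartIILemmas
import HarnessLib

/-!
# [IUTchIV] Theorem 1.10 ⟹ its application in Corollary 2.2 (ii): the junction between the tree's
# `Thm110Numerics` (Cor. 3.12 as the hypothesis `Cor312`) and the `λ`-line interface `Cor22.Thm110Legendre`

Mochizuki, *Inter-universal Teichmüller theory IV*, RIMS manuscript (Apr. 2020; = PRIMS **57** (2021)),
Thm. 1.10 pp. 22–23 (first display: "`(1/6)·log(q) ≤ (1 + 20·d_mod/l)·(log(𝔡^{F_tpd}) + log(𝔣^{F_tpd})) +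
20·(e*_mod·l + η_prm)`"), applied in the proof of Cor. 2.2 (ii) p. 46 l. 1 ("In light of (P7), we may apply
Theorem 1.10 … `≤ … + 20·(d*_mod·l + η_prm)`", with `e*_mod ≤ d*_mod`, p. 22).

The tree has BOTH ends of this sentence:
* `Thm110Numerics.theorem110` (`Theorem110.lean`, abc-iut-S3 gen 0): for ANY numerics `X` of the statement of
  Thm. 1.10 — with proof data `X.ProofData` (Steps (ii)–(vii) inputs: the classical Prop. 1.3/1.8 fields and the
  log-volume field `hull_le`), `IsEtaPrm X.etaPrm`, `X.l ≠ 5`, and the HYPOTHESIS `X.Cor312` ([IUTchIII]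
  Cor. 3.12 for these data) — the display `X.Display`; its Dupuy–Hilado-model form is
  `Summit.ABC.IUTFork.DHData.theorem110_of_DH` (abc-iut-S2);
* `Cor22.Thm110Legendre` (`Corollary22Legendre.lean`, abc-iut-S-d2): the display AS CONSUMED by Cor. 2.2 (ii)
  for the point `x_E = λ` and the prime `l` (`Cor22.Display P l η`), the named input under which
  `Cor22.partII_of_thm110Legendre` (`Corollary22PartII.lean`) PROVES Cor. 2.2 (ii).

This file PROVES the junction (classical, definitional bookkeeping): if the numerics `X` are those of the
point — `X.l = l`, `X.dmod = d_mod(λ)`, `X.etaPrm = η`, `X.logDiffTpd = log-diff(λ)`, `X.logCondTpd =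
log(𝔣^{F_tpd}) = logCondAvoid P {2,l}`, `X.logq = log(q^{∤2l}(λ))` — then `X.Display → Cor22.Display P l η`
(`display_of_matches`, using `e*_mod ≤ d*_mod`), hence `Cor22.Display P l η` from proof data + `Cor312`
(`display_of_proofData`), and the SCHEMA-LEVEL reduction (`thm110Legendre_of_matchingNumerics`):

  `Cor22.Thm110Legendre` follows from: "for every admissible `(λ, l)` [the antecedents of `Thm110Legendre`:
  `AdmitsCore`, (P2), (P5), (P6), `l ≥ 5` prime] there are numerics `X` matching the point with `X.l ≠ 5`,
  proof data for `X`, and `X.Cor312`" — i.e. from (P7) [existence of the Θ-data, whose numerics are `X`;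
  `l ≠ 5` by [IUTchI] Def. 3.1 (c), p. 22], Steps (ii)–(vii) of the proof of Thm. 1.10 [`ProofData`: the
  campaign's D9′ obligations O1–O6], and [IUTchIII] Cor. 3.12 [`Cor312`, THE disputed hypothesis].

(Revision note, dedup repair: the sibling `Corollary22Thm110Reduction.lean` (abc-iut-S-d2) landed in the same
gate batch with the names `display_of_numerics` / `thm110Legendre_of_numerics` for its equality-hypothesis
forms; this file's `Matches`-based forms are renamed `display_of_matches` / `thm110Legendre_of_matchingNumerics`
so that the two modules are co-importable.)

So the S-chain reads, kernel-checked: `Cor312` (per Θ-data) + `ProofData` ⟹ `Thm110Legendre` ⟹ (with the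
classical `FullGaloisImage`, proved) Cor. 2.2 (ii) ⟹ Cor. 2.2 ⟹ Cor. 2.3 ⟹ abc (modulo [GenEll] Thm. 2.1).
TAKES NO SIDE on [IUTchIII] Cor. 3.12: it is the hypothesis `Cor312` throughout; nothing is asserted about any
elliptic curve. Deliberately NOT here: any construction of `X`/`ProofData` from real Θ-data (campaign M / D9′).
-/

noncomputable section

namespace Literature.IUT.LogVolume

namespace Cor22

open Literature.NumberTheory.DiophantineGeometry.GenEll

/-- **The numerics of Thm. 1.10 MATCH the point `(λ, l, η_prm)`**: `X.l = l`, `X.dmod = d_mod = [ℚ(j(λ)):ℚ]`,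
`X.etaPrm = η_prm`, `X.logDiffTpd = log-diff_X(x_E) = log(𝔡^{F_tpd})` (p. 43), `X.logCondTpd = log(𝔣^{F_tpd})`
and `X.logq = log(q) = log(q^{∤{2,l}}(λ))` ((P5), p. 46) — the identifications (P7) makes when it takes "`F`",
"`X_F`", "`l`", "`𝕍^bad_mod`" to be those of the point (p. 46). (`e_mod`, `F`, `K`-level fields of `X` are
unconstrained: the consumed display only sees them through `e*_mod ≤ d*_mod`.)
[claim: Mochizuki2012, status: disputed] -/
structure Matches (X : Thm110Numerics) (P : NFPoint) (l : ℕ) (η : ℝ) : Prop where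
  /-- the prime `l` of the Θ-data is the chosen `l` -/
  l_eq : X.l = l
  /-- `d_mod = [F_mod : ℚ]`, `F_mod = ℚ(j(λ))` -/
  dmod_eq : X.dmod = dmod P
  /-- `η_prm` -/
  etaPrm_eq : X.etaPrm = η
  /-- `log(𝔡^{F_tpd}) = log-diff_X(x_E)` (p. 43) -/
  logDiffTpd_eq : X.logDiffTpd = P.logDiff
  /-- `log(𝔣^{F_tpd})` = the reduced bad divisor of `λ` away from `2l` -/
  logCondTpd_eq : X.logCondTpd = logCondAvoid P {2, l}
  /-- `log(q) = log(q^{∤{2,l}}(λ))` -/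
  logq_eq : X.logq = logQAvoid P {2, l}

/-- **`X.Display ⟹ Cor22.Display`** for matching numerics: the printed display of Thm. 1.10 (with `e*_mod`)
implies its applied form on p. 46 l. 1 (with `d*_mod`), since "`e*_mod ≤ d*_mod`" (p. 22).
[claim: Mochizuki2012, status: disputed] -/
theorem display_of_matches {X : Thm110Numerics} {P : NFPoint} {l : ℕ} {η : ℝ} (hM : Matches X P l η)
    (hdisp : X.Display) : Display P l η := by
  unfold Display
  unfold Thm110Numerics.Display at hdisp
  rw [hM.l_eq, hM.dmod_eq, hM.etaPrm_eq, hM.logDiffTpd_eq, hM.logCondTpd_eq, hM.logq_eq] at hdisp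
  -- `e*_mod ≤ d*_mod`
  have he : (X.estar : ℝ) ≤ 2 ^ 12 * 3 ^ 3 * 5 * (dmod P : ℝ) := by
    have h1 : X.estar ≤ 2 ^ 12 * 3 ^ 3 * 5 * X.dmod := by
      unfold Thm110Numerics.estar
      exact Nat.mul_le_mul_left _ X.emod_le_dmod
    rw [hM.dmod_eq] at h1
    exact_mod_cast h1
  have hl0 : (0 : ℝ) ≤ l := Nat.cast_nonneg _
  nlinarith [mul_le_mul_of_nonneg_right he hl0]

/-- **Thm. 1.10 ⟹ the display consumed by Cor. 2.2 (ii)**: for numerics matching `(λ, l, η_prm)` with proof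
data (Steps (ii)–(vii)), `η_prm` as in Prop. 1.6, `l ≠ 5`, and the HYPOTHESIS `Cor312`, the display
`Cor22.Display P l η_prm` holds (via `Thm110Numerics.theorem110`). [claim: Mochizuki2012, status: disputed] -/
theorem display_of_proofData {X : Thm110Numerics} {P : NFPoint} {l : ℕ} {η : ℝ} (hM : Matches X P l η)
    (PD : X.ProofData) (hη : IsEtaPrm η) (hne : X.l ≠ 5) (hcor : X.Cor312) : Display P l η := by
  have hη' : IsEtaPrm X.etaPrm := by rw [hM.etaPrm_eq]; exact hη
  exact display_of_matches hM (X.theorem110 PD hη' hne hcor).2.2.1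

/-- **The schema-level junction.** `Cor22.Thm110Legendre` — the input of the tree's proof of Cor. 2.2 (ii) —
follows from: for every `η_prm` (Prop. 1.6), every `λ ∈ U_X` presented minimally and every prime `l ≥ 5` with
"admits an `F`-core", (P2), (P5), (P6), there exist numerics `X` of Thm. 1.10 matching `(λ, l, η_prm)` with
`X.l ≠ 5` ([IUTchI] Def. 3.1 (c), p. 22), proof data for `X` (Steps (ii)–(vii)), and `X.Cor312` ([IUTchIII]
Cor. 3.12 for these Θ-data) — which is (P7) + the proof of Thm. 1.10 + Cor. 3.12, separated into its three
named parts. [claim: Mochizuki2012, status: disputed] -/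
theorem thm110Legendre_of_matchingNumerics
    (H : ∀ η : ℝ, IsEtaPrm η → ∀ P : NFPoint, P ∈ UP → ∀ l : ℕ, l.Prime → 5 ≤ l →
      AdmitsCore P → CondP2 P l → CondP5 P l → CondP6 P l →
        ∃ X : Thm110Numerics, Matches X P l η ∧ X.l ≠ 5 ∧ Nonempty X.ProofData ∧ X.Cor312) :
    Thm110Legendre := by
  intro η hη P hP l hl h5 hcore h2 h5' h6
  obtain ⟨X, hM, hne, ⟨PD⟩, hcor⟩ := H η hη P hP l hl h5 hcore h2 h5' h6
  exact display_of_proofData hM PD hη hne hcor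

end Cor22

end Literature.IUT.LogVolume

end
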